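import Summits.QuantumFields.YangMills.Theorems.BalabanUVNodesN15KingModelCurvedKnitFlat

/-!
# BalabanUVNodes ∕ N15 — THE KING-MODEL RUNG, PART Ω-d: TWO CONCRETE GENERATOR DATA FOR THE KING INHABITANT OF dag-n15-w3's CURVED KNIT — the TRIVIAL generator
# (every displayed hypothesis discharged: a CLOSED η-rate statement) and KING's OWN U(1) TRANSPORTER `e^{iη′θ}` (ℂ as an ℝ-algebra, basis `(1, i)`, generator `θ_μ·(i·)`,
# skew coordinates `θ_μ·[[0,−1],[1,0]]`)

HONEST FRAMING.  Count-neutral helper (cell `pub-ymgap`, seat `pub-ymgap-dag-n15-e` g14; `--supports stmt-QuantumFields-20544 --as helper` = K3⁷ `SpineGivenEndpointR13SepCoPH`;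
FAN-OUT v1.1 §N15 s3 «KING-MODEL ∕ RIEMANN-KERNEL RUNG»).  TEMPLATE LITERATURE: C. King's U(1)-Higgs MODEL on finite tori ([King1986] (2.1)–(2.5) p. 652: the covariant
difference with the U(1) transporter `e^{iηA}`; (2.13) p. 653, (4.1)–(4.5) p. 670).  Part Ω-c (`…KingModelCurvedKnitFlat`) inhabits dag-n15-w3's curved knit
`CurvedSpecies.hasMaj_idef_curvDressed_kingTorus` with King's full `A = 0` propagator, leaving displayed exactly a coordinate system `e : 𝔄 ≃ ℝ^ι`, a constant generator datum
`Zc` (`‖Zc μ‖ ≤ r ≤ 1`, skew coordinates) and the Neumann smallness `hq`.  THIS FILE supplies two concrete data: §1 the TRIVIAL generator `(𝔄, ι, e) = (ℝ, Unit, funUnique)`,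
`Zc = 0`, `r = 0` — the row letter vanishes (`expRowLetter_zero`), `hq` is automatic, and part Ω-c's explicit η-rate becomes a CLOSED statement: the two-grid defect of the
(trivially dressed) stacked pair `(G, D⁺G, D⁻G)` of King's propagator through the knit's resolvent is `≤ 2c_r·m·θ_K·e^{−(δ∕2)|y−y′|_T}`, `θ_K = (L^K)^{−γ∕2} + (L^K)^{−α}`, for EVERY `K ≥ 1`, cube,
mass, size datum — no hypothesis left; §2 King's own abelian transporter: `𝔄 = ℂ` over ℝ, `ι = Fin 2`, `e = Complex.basisOneI.equivFun` (coordinates `(re, im)`),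
`Zc μ = θ_μ • (i·)` (`ContinuousLinearMap.mul ℝ ℂ I`): its coordinates are `θ_μ·[[0,−1],[1,0]]` — SKEW (`coordMat_mulI`, `transpose_coordMat_smul_mulI`) — and `‖Zc μ‖ = |θ_μ|`, so
part Ω-c applies with `r = max_μ|θ_μ|`-type bounds: the dressed pair of King's propagator by a CONSTANT U(1) gauge field `A_μ ≡ θ_μ` (transporter `e^{iη′θ_μ}`), `hq` = smallness of `θ`.
* §1 `expRowLetter_zero`, ★ `hasMaj_idef_curvDressed_kingTorus_king_trivial` (closed η-rate statement).
* §2 `coordMat_mulI` (`= !![0, -1; 1, 0]`), `transpose_coordMat_smul_mulI` (skew), `norm_smul_mulI` (`= |θ|`), ★ `hasMaj_idef_curvDressed_kingTorus_king_U1` (part Ω-c's `_rate` at King's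
  U(1) datum: displayed only `|θ_μ| ≤ r ≤ 1` and the halved smallness in `r`).
0 `sorry`, standard axioms; no `def`.  HONEST SCOPE: King's `A = 0` propagator dressed at the FLAT base point by a CONSTANT abelian transporter (§2) or not at all (§1); a positive
control ∕ non-vacuity certificate, not an estimate of Bałaban's `G(U)`; not a discharge of N15; NE2⁺ NOT PRINTED ∕ not proved; one finite 𝕋⁴ programme at fixed ε — nothing
continuum ∕ ℝ⁴ ∕ OS ∕ mass-gap ∕ Clay.
Locators: [King1986] (2.1)–(2.5) p. 652, (2.13)–(2.17) p. 653, Thm 3.3 p. 655, (3.7)–(3.8) p. 656, Prop. 3.9 (3.73) p. 665; [Balaban1985BackgroundPropagators] (3.37) p. 396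
(`U′ = e^{iηA′}`: shape), Thm 3.1 (3.42)–(3.43) pp. 397–398, (3.63)–(3.65) pp. 402–403 (mechanism).
-/

noncomputable section

namespace Summit.QuantumFields.YangMills.BalabanUVNodes.N15KingModelRung.Curved

open Real Finset Matrix NormedSpace
open Literature.MathematicalPhysics.QuantumFieldTheory.Balaban1983to89
open Literature.MathematicalPhysics.QuantumFieldTheory.Balaban1983to89.B11SectG (BlockNorm HasMaj RowSum)
open Literature.MathematicalPhysics.QuantumFieldTheory.Balaban1983to89.T4EtaRateDefect (idef)
open Literature.MathematicalPhysics.QuantumFieldTheory.Balaban1983to89.T4EtaRateCoeffDefect (pull)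
open Literature.MathematicalPhysics.QuantumFieldTheory.Balaban1983to89.B5Prop11Plancherel (Tor fine)
open Literature.MathematicalPhysics.QuantumFieldTheory.King1986 (aK)
open Literature.MathematicalPhysics.QuantumFieldTheory.King1986.Torus (blockOf tdistT)
open Summit.QuantumFields.YangMills.BalabanUVNodes.N15.VectorPiece (unitTorusGeoS)
open Summit.QuantumFields.YangMills.BalabanUVNodes.N15.MatrixSpecies (liftMap liftBlk coordMat coordMat_sub basisConst basisConst_nonneg)
open Summit.QuantumFields.YangMills.BalabanUVNodes.N15.BackgroundLayer (liftPair blkPair coordMat_smul)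
open Summit.QuantumFields.YangMills.BalabanUVNodes.N15.CurvedSpecies (torStep blockMeanField curvDressed expTrField expRowLetter curvRowLetter)

variable {d : ℕ} (L : ℕ)

/-! ## §1 The trivial generator: a closed η-rate statement -/

section Trivial

/-- At the zero generator the row letter vanishes: `expRowLetter κ 0 0 0 = 0`. [folklore] -/
theorem expRowLetter_zero (ι J : Type) [Fintype ι] [Fintype J] (κ : ℝ) : expRowLetter ι J κ 0 0 0 = 0 := by
  unfold expRowLetter curvRowLetter
  ring

variable [NeZero L]

/-- ★ **THE CLOSED η-RATE STATEMENT (trivial generator).**  For odd `L ≥ 3`, `a > 0`, `m₀² ≥ 0`, `0 < γ < 1`, `0 < α < 1` there are `δ, C > 0` such that for EVERY `K ≥ 1`, cube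
`M₀ ≡ 2L^e`, mass `0 < m² ≤ m₀²` and size datum, the η-defect of dag-n15-w3's dressed pairs of King's full `A = 0` propagator (coarse `A₀⁻¹ ⊗ 1` on `Tor (fine (L^K) M₀)`, fine
`(cast∘A₀′⁻¹∘cast⁻¹) ⊗ 1` on `Tor (fine L (fine (L^K) M₀))`, trivial transporters: `W′ = Z′ = 0`, scalar fibre `ι = Unit`, `e = funUnique⁻¹`) has the block majorant
`C·((L^K)^{−γ∕2} + (L^K)^{−α})·e^{−(δ∕2)|y−y′|_T}` — part Ω-c's `…_king_rate` at `Zc = 0`, `r = 0`, where the Neumann smallness holds trivially (`expRowLetter_zero`); NO hypothesis left.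
[cite: King1986, (2.13)–(2.17) p.653, Thm 3.3 p.655, (3.7)–(3.8) p.656, Prop. 3.9 (3.73) p.665; Balaban1985BackgroundPropagators, Thm 3.1 (3.42)–(3.43) pp.397–398, (3.63)–(3.65) pp.402–403 (mechanism)] -/
theorem hasMaj_idef_curvDressed_kingTorus_king_trivial (hLodd : Odd L) (hL : 2 ≤ L) {a : ℝ} (ha : 0 < a) {m0sq : ℝ} (hm0 : 0 ≤ m0sq) {γ : ℝ} (hγ0 : 0 < γ)
    (hγ1 : γ < 1) {α : ℝ} (hα0 : 0 < α) (hα1 : α < 1) :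
    ∃ δ C : ℝ, 0 < δ ∧ 0 < C ∧ ∀ (K : ℕ), 1 ≤ K → ∀ (e : ℕ) (M : Fin (d + 1) → ℕ) [∀ μ, NeZero (M μ)], (∀ μ, M μ = 2 * L ^ e) →
      ∀ (msq : ℝ), 0 < msq → msq ≤ m0sq → ∀ (Msz : ℝ),
      HasMaj (BlockNorm.ofBlocks (unitTorusGeoS L K M Msz) (liftBlk (blockOf (L ^ K) M) Unit))
        (BlockNorm.ofBlocks (unitTorusGeoS L K M Msz) (blkPair (liftBlk (blockOf (L ^ K) M ∘ blockOf L (fine (L ^ K) M)) Unit)))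
        (idef (pull (liftMap (blockOf L (fine (L ^ K) M)) Unit)) (pull (liftPair (liftMap (blockOf L (fine (L ^ K) M)) Unit)))
          (curvDressed ((L : ℝ) ^ (K + 1))⁻¹ (torStep (fine L (fine (L ^ K) M)))
            (expTrField (ContinuousLinearEquiv.funUnique Unit ℝ ℝ).symm ((L : ℝ) ^ (K + 1))⁻¹ 0)
            (expTrField (ContinuousLinearEquiv.funUnique Unit ℝ ℝ).symm ((L : ℝ) ^ (K + 1))⁻¹ (fun μ _ => (0 : Fin (d + 1) → (ℝ →L[ℝ] ℝ)) μ))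
            (kingGT₁ L a msq K M Unit))
          (curvDressed ((L : ℝ) * ((L : ℝ) ^ (K + 1))⁻¹) (torStep (fine (L ^ K) M))
            (expTrField (ContinuousLinearEquiv.funUnique Unit ℝ ℝ).symm ((L : ℝ) * ((L : ℝ) ^ (K + 1))⁻¹) (blockMeanField L (fine (L ^ K) M) 0))
            (expTrField (ContinuousLinearEquiv.funUnique Unit ℝ ℝ).symm ((L : ℝ) * ((L : ℝ) ^ (K + 1))⁻¹)
              (blockMeanField L (fine (L ^ K) M) (fun μ _ => (0 : Fin (d + 1) → (ℝ →L[ℝ] ℝ)) μ)))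
            (kingGT L a msq K M Unit)))
        (fun y y' => C * (((L : ℝ) ^ K) ^ (-(γ / 2)) + ((L : ℝ) ^ K) ^ (-α)) * Real.exp (-(δ / 2 * tdistT M y y'))) := by
  obtain ⟨β, δ, m, hβ, hδ, hm, H⟩ := hasMaj_idef_curvDressed_kingTorus_king_rate (d := d) L hLodd hL ha hm0 hγ0 hγ1 hα0 hα1
  have hcr : 0 < B4Sect5Proof.latticeConst (d + 1) (δ / 2) := by
    unfold B4Sect5Proof.latticeConst
    have h1 : Real.exp (-(δ / 2 / ((d + 1 : ℕ) : ℝ))) < 1 := Real.exp_lt_one_iff.mpr (by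
      have : (0 : ℝ) < ((d + 1 : ℕ) : ℝ) := by positivity
      exact neg_lt_zero.mpr (div_pos (half_pos hδ) this))
    positivity
  refine ⟨δ, 2 * B4Sect5Proof.latticeConst (d + 1) (δ / 2) * m, hδ, by positivity, fun K hK e M _ hM msq hmsq hcap Msz => ?_⟩
  have hskew : ∀ μ : Fin (d + 1), (coordMat (ContinuousLinearEquiv.funUnique Unit ℝ ℝ).symm ((0 : Fin (d + 1) → (ℝ →L[ℝ] ℝ)) μ))ᵀ =
      -coordMat (ContinuousLinearEquiv.funUnique Unit ℝ ℝ).symm ((0 : Fin (d + 1) → (ℝ →L[ℝ] ℝ)) μ) := fun μ => by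
    have h0 := coordMat_sub (ContinuousLinearEquiv.funUnique Unit ℝ ℝ).symm (0 : ℝ →L[ℝ] ℝ) 0
    rw [sub_self, sub_self] at h0
    rw [Pi.zero_apply, h0, Matrix.transpose_zero, neg_zero]
  have hq : β * (expRowLetter Unit (Fin (d + 1)) (basisConst (ContinuousLinearEquiv.funUnique Unit ℝ ℝ).symm) 0 0 0 *
      (1 + Fintype.card (Fin (d + 1) ⊕ Fin (d + 1)))) * B4Sect5Proof.latticeConst (d + 1) (δ / 2) ≤ 1 / 2 := by
    rw [expRowLetter_zero, zero_mul, mul_zero, zero_mul]; norm_num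
  have key := H K hK e M hM msq hmsq hcap Msz Unit ℝ (ContinuousLinearEquiv.funUnique Unit ℝ ℝ).symm 0 0 le_rfl zero_le_one
    (fun μ => by rw [Pi.zero_apply, norm_zero]) hskew hq
  refine key.mono fun y y' => le_of_eq ?_
  rw [expRowLetter_zero]
  ring

end Trivial

/-! ## §2 King's own U(1) transporter: `ℂ` over `ℝ` in the basis `(1, i)`, generator `θ·(i·)` -/

section U1

/-- THE COORDINATES OF MULTIPLICATION BY `i` in the basis `(1, i)` of `ℂ` over `ℝ`: the rotation generator `[[0, −1], [1, 0]]`.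
[cite: King1986, (2.1)–(2.5) p.652 (the U(1) transporter `e^{iηA}`: shape)] -/
theorem coordMat_mulI : coordMat Complex.basisOneI.equivFun.toContinuousLinearEquiv (ContinuousLinearMap.mul ℝ ℂ Complex.I) = !![0, -1; 1, 0] := by
  ext i j
  rw [coordMat, LinearMap.toMatrix'_apply]
  fin_cases i <;> fin_cases j <;>
    simp [ContinuousLinearMap.mul_apply', Pi.single_apply]

/-- THE U(1) GENERATOR IS SKEW IN THESE COORDINATES: `(θ·[[0,−1],[1,0]])ᵀ = −θ·[[0,−1],[1,0]]`. [folklore] -/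
theorem transpose_coordMat_smul_mulI (θ : ℝ) :
    (coordMat Complex.basisOneI.equivFun.toContinuousLinearEquiv (θ • ContinuousLinearMap.mul ℝ ℂ Complex.I))ᵀ =
      -coordMat Complex.basisOneI.equivFun.toContinuousLinearEquiv (θ • ContinuousLinearMap.mul ℝ ℂ Complex.I) := by
  rw [coordMat_smul, coordMat_mulI, Matrix.transpose_smul, ← smul_neg]
  congr 1
  ext i j
  fin_cases i <;> fin_cases j <;> simp

/-- THE SIZE OF THE U(1) GENERATOR: `‖θ·(i·)‖ = |θ|` (`‖i·‖ = ‖i‖ = 1` in the C⋆-algebra `ℂ`). [folklore] -/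
theorem norm_smul_mulI (θ : ℝ) : ‖θ • ContinuousLinearMap.mul ℝ ℂ Complex.I‖ = |θ| := by
  rw [norm_smul, ContinuousLinearMap.opNorm_mul_apply, Complex.norm_I, mul_one, Real.norm_eq_abs]

variable [NeZero L]

/-- ★ **THE KING INHABITANT WITH KING's OWN U(1) TRANSPORTER.**  Part Ω-c's explicit η-rate `hasMaj_idef_curvDressed_kingTorus_king_rate` at the generator datum `𝔄 = ℂ` (over ℝ),
`ι = Fin 2`, `e = (re, im)`, `Zc μ = θ_μ·(i·)` — the dressed pair of King's full `A = 0` propagator by the CONSTANT abelian gauge field `A_μ ≡ θ_μ` (transporter `e^{iη′θ_μ}` on the fine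
torus, `e^{iηθ_μ}` on the coarse one; a flat U(1) connection), for every `θ` with `|θ_μ| ≤ r ≤ 1` under the halved Neumann smallness in `r` (a small-field condition).  Displayed: nothing
else. [cite: King1986, (2.1)–(2.5) p.652, (2.13)–(2.17) p.653, Prop. 3.9 (3.73) p.665; Balaban1985BackgroundPropagators, (3.37) p.396 (`U′ = e^{iηA′}`: shape), (3.63)–(3.65) pp.402–403 (mechanism)] -/
theorem hasMaj_idef_curvDressed_kingTorus_king_U1 (hLodd : Odd L) (hL : 2 ≤ L) {a : ℝ} (ha : 0 < a) {m0sq : ℝ} (hm0 : 0 ≤ m0sq) {γ : ℝ} (hγ0 : 0 < γ)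
    (hγ1 : γ < 1) {α : ℝ} (hα0 : 0 < α) (hα1 : α < 1) :
    ∃ β δ m : ℝ, 0 < β ∧ 0 < δ ∧ 0 < m ∧ ∀ (K : ℕ), 1 ≤ K → ∀ (e : ℕ) (M : Fin (d + 1) → ℕ) [∀ μ, NeZero (M μ)], (∀ μ, M μ = 2 * L ^ e) →
      ∀ (msq : ℝ), 0 < msq → msq ≤ m0sq → ∀ (Msz : ℝ) (θ : Fin (d + 1) → ℝ) (r : ℝ), 0 ≤ r → r ≤ 1 → (∀ μ, |θ μ| ≤ r) →
      β * (expRowLetter (Fin 2) (Fin (d + 1)) (basisConst Complex.basisOneI.equivFun.toContinuousLinearEquiv) r 0 0 * (1 + Fintype.card (Fin (d + 1) ⊕ Fin (d + 1)))) *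
        B4Sect5Proof.latticeConst (d + 1) (δ / 2) ≤ 1 / 2 →
      HasMaj (BlockNorm.ofBlocks (unitTorusGeoS L K M Msz) (liftBlk (blockOf (L ^ K) M) (Fin 2)))
        (BlockNorm.ofBlocks (unitTorusGeoS L K M Msz) (blkPair (liftBlk (blockOf (L ^ K) M ∘ blockOf L (fine (L ^ K) M)) (Fin 2))))
        (idef (pull (liftMap (blockOf L (fine (L ^ K) M)) (Fin 2))) (pull (liftPair (liftMap (blockOf L (fine (L ^ K) M)) (Fin 2))))
          (curvDressed ((L : ℝ) ^ (K + 1))⁻¹ (torStep (fine L (fine (L ^ K) M)))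
            (expTrField Complex.basisOneI.equivFun.toContinuousLinearEquiv ((L : ℝ) ^ (K + 1))⁻¹ 0)
            (expTrField Complex.basisOneI.equivFun.toContinuousLinearEquiv ((L : ℝ) ^ (K + 1))⁻¹ (fun μ _ => θ μ • ContinuousLinearMap.mul ℝ ℂ Complex.I))
            (kingGT₁ L a msq K M (Fin 2)))
          (curvDressed ((L : ℝ) * ((L : ℝ) ^ (K + 1))⁻¹) (torStep (fine (L ^ K) M))
            (expTrField Complex.basisOneI.equivFun.toContinuousLinearEquiv ((L : ℝ) * ((L : ℝ) ^ (K + 1))⁻¹) (blockMeanField L (fine (L ^ K) M) 0))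
            (expTrField Complex.basisOneI.equivFun.toContinuousLinearEquiv ((L : ℝ) * ((L : ℝ) ^ (K + 1))⁻¹)
              (blockMeanField L (fine (L ^ K) M) (fun μ _ => θ μ • ContinuousLinearMap.mul ℝ ℂ Complex.I)))
            (kingGT L a msq K M (Fin 2))))
        (fun y y' => 2 * B4Sect5Proof.latticeConst (d + 1) (δ / 2) *
            (m * (((L : ℝ) ^ K) ^ (-(γ / 2)) + ((L : ℝ) ^ K) ^ (-α)) *
                (1 + 2 * β * (expRowLetter (Fin 2) (Fin (d + 1)) (basisConst Complex.basisOneI.equivFun.toContinuousLinearEquiv) r 0 0 *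
                  (1 + Fintype.card (Fin (d + 1) ⊕ Fin (d + 1))))) +
              2 * β ^ 2 * (2 * basisConst Complex.basisOneI.equivFun.toContinuousLinearEquiv * Real.exp 1 * r ^ 2 * ((L : ℝ) * ((L : ℝ) ^ (K + 1))⁻¹) *
                ((Fintype.card (Fin 2) : ℝ) + (Fintype.card (Fin 2) : ℝ) ^ 3 +
                  2 * (Fintype.card (Fin 2) : ℝ) ^ 2 * (Fintype.card (Fin (d + 1)) : ℝ) * (basisConst Complex.basisOneI.equivFun.toContinuousLinearEquiv * Real.exp 1 * r)) *
                (1 + Fintype.card (Fin (d + 1) ⊕ Fin (d + 1))))) *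
          Real.exp (-(δ / 2 * tdistT M y y'))) := by
  obtain ⟨β, δ, m, hβ, hδ, hm, H⟩ := hasMaj_idef_curvDressed_kingTorus_king_rate (d := d) L hLodd hL ha hm0 hγ0 hγ1 hα0 hα1
  refine ⟨β, δ, m, hβ, hδ, hm, fun K hK e M _ hM msq hmsq hcap Msz θ r hr0 hr1 hθ hq2 => ?_⟩
  exact H K hK e M hM msq hmsq hcap Msz (Fin 2) ℂ Complex.basisOneI.equivFun.toContinuousLinearEquiv (fun μ => θ μ • ContinuousLinearMap.mul ℝ ℂ Complex.I) r hr0 hr1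
    (fun μ => by rw [norm_smul_mulI]; exact hθ μ) (fun μ => transpose_coordMat_smul_mulI (θ μ)) hq2

end U1

end Summit.QuantumFields.YangMills.BalabanUVNodes.N15KingModelRung.Curved

end
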